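import Summits.CriticalPhenomena.PercolationContinuityZ3.Theorems.PercNearOneGluingNoHeavyLowerTailFrontierDecRowsClusterMarkov
import HarnessLib

/-!
# The cluster-Markov / BHK criterion, second form: killing sets — two more four-point dec `E₃` orbits (tree rows `11`, `31`) for every `n`

Support file (prover prim-l12-p1 gen 2, P1 line; `--supports stmt-CriticalPhenomena-4575`).  No definitions, no named facts, no sorries, no `native_decide`.

Extension of `…FrontierDecRowsClusterMarkovCore`: in `E₃(D[P|Q], {s ↮ X}, D[P'|Q'])` the far sides `Q, Q'` need only lie inside `X ∪ Z` for a common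
"killing set" `Z` with `s ∈ P, Z ⊆ Q` and `s ∈ P', Z ⊆ Q'`: then both outer events are contained in `{s ↮ Z}`, so their traces on `D = {s ↮ X}` and on
`D' = {s ↮ X ∪ Z}` coincide, the conditional positive correlation given `D'` (the Core criterion) transfers to `D` because `μ(D') ≤ μ(D)`, and Sahi's
`E₃` with middle `D` follows by the conditional-Harris reduction.  New all-`n` rows of `…FrontierDecRowsLeFive`:
* row `11` = `(D[ab|c], D[ac|by], D[ay|b])` (middle `{b ↮ ay}`, `Z = {c}`);
* row `31` = `(D[ab|c], D[ac|y], D[bc|y])` (middle `{c ↮ ab}`, `Z = {y}`).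
After this file 8 of the 37 unimplied FRONTIER-4PT dec orbits remain open for general `n`: tree rows `12, 15, 27, 30, 33, 36 (PATH), 37, 44`.
-/

noncomputable section

namespace Summit.CriticalPhenomena.PercolationContinuityZ3.Theorems

namespace ClusterMarkovE3

open MeasureTheory Literature.Probability.Percolation Literature.Probability.LatticeModels

variable {V : Type*} [Fintype V]

/-- **Criterion with a killing set.**  For `Q, Q' ⊆ X ∪ Z`, `s ∈ P`, `s ∈ P'`, `Z ⊆ Q`, `Z ⊆ Q'`:
`μ(D ∩ D[P|Q]) · μ(D ∩ D[P'|Q']) ≤ μ(D) · μ(D ∩ D[P|Q] ∩ D[P'|Q'])` with `D = {s ↮ X}`. [this work] -/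
theorem sep_sep_posCorrelation_notReach_kill (w : Sym2 V → unitInterval) (s : V) (X Z P Q P' Q' : Set V)
    (hQ : Q ⊆ X ∪ Z) (hQ' : Q' ⊆ X ∪ Z) (hsP : s ∈ P) (hsP' : s ∈ P') (hZQ : Z ⊆ Q) (hZQ' : Z ⊆ Q') :
    (prodBernoulli w).real ({ω : BondConfig V | ∀ x ∈ X, ¬ (openGraph ω).Reachable s x} ∩
        {ω : BondConfig V | ∀ p ∈ P, ∀ q ∈ Q, ¬ (openGraph ω).Reachable p q}) *
      (prodBernoulli w).real ({ω : BondConfig V | ∀ x ∈ X, ¬ (openGraph ω).Reachable s x} ∩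
        {ω : BondConfig V | ∀ p ∈ P', ∀ q ∈ Q', ¬ (openGraph ω).Reachable p q}) ≤
    (prodBernoulli w).real {ω : BondConfig V | ∀ x ∈ X, ¬ (openGraph ω).Reachable s x} *
      (prodBernoulli w).real ({ω : BondConfig V | ∀ x ∈ X, ¬ (openGraph ω).Reachable s x} ∩
        ({ω : BondConfig V | ∀ p ∈ P, ∀ q ∈ Q, ¬ (openGraph ω).Reachable p q} ∩
          {ω : BondConfig V | ∀ p ∈ P', ∀ q ∈ Q', ¬ (openGraph ω).Reachable p q})) := by
  have h := sep_sep_posCorrelation_notReach w s (X ∪ Z) P Q P' Q' hQ hQ'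
  -- the traces on `D' = {s ↮ X ∪ Z}` are the traces on `D = {s ↮ X}`
  have hD' : {ω : BondConfig V | ∀ x ∈ X ∪ Z, ¬ (openGraph ω).Reachable s x} =
      {ω : BondConfig V | ∀ x ∈ X, ¬ (openGraph ω).Reachable s x} ∩
        {ω : BondConfig V | ∀ z ∈ Z, ¬ (openGraph ω).Reachable s z} := by
    ext ω
    simp only [Set.mem_setOf_eq, Set.mem_inter_iff, Set.mem_union]
    constructor
    · intro hω; exact ⟨fun x hx => hω x (Or.inl hx), fun z hz => hω z (Or.inr hz)⟩
    · rintro ⟨h1, h2⟩ x (hx | hx); exacts [h1 x hx, h2 x hx]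
  have hA : {ω : BondConfig V | ∀ p ∈ P, ∀ q ∈ Q, ¬ (openGraph ω).Reachable p q} ⊆
      {ω : BondConfig V | ∀ z ∈ Z, ¬ (openGraph ω).Reachable s z} := fun ω hω z hz => hω s hsP z (hZQ hz)
  have hC : {ω : BondConfig V | ∀ p ∈ P', ∀ q ∈ Q', ¬ (openGraph ω).Reachable p q} ⊆
      {ω : BondConfig V | ∀ z ∈ Z, ¬ (openGraph ω).Reachable s z} := fun ω hω z hz => hω s hsP' z (hZQ' hz)
  have e1 : {ω : BondConfig V | ∀ x ∈ X ∪ Z, ¬ (openGraph ω).Reachable s x} ∩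
      {ω : BondConfig V | ∀ p ∈ P, ∀ q ∈ Q, ¬ (openGraph ω).Reachable p q} =
      {ω : BondConfig V | ∀ x ∈ X, ¬ (openGraph ω).Reachable s x} ∩
        {ω : BondConfig V | ∀ p ∈ P, ∀ q ∈ Q, ¬ (openGraph ω).Reachable p q} := by
    rw [hD', Set.inter_assoc, Set.inter_eq_right.2 hA]
  have e2 : {ω : BondConfig V | ∀ x ∈ X ∪ Z, ¬ (openGraph ω).Reachable s x} ∩
      {ω : BondConfig V | ∀ p ∈ P', ∀ q ∈ Q', ¬ (openGraph ω).Reachable p q} =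
      {ω : BondConfig V | ∀ x ∈ X, ¬ (openGraph ω).Reachable s x} ∩
        {ω : BondConfig V | ∀ p ∈ P', ∀ q ∈ Q', ¬ (openGraph ω).Reachable p q} := by
    rw [hD', Set.inter_assoc, Set.inter_eq_right.2 hC]
  have e12 : {ω : BondConfig V | ∀ x ∈ X ∪ Z, ¬ (openGraph ω).Reachable s x} ∩
      ({ω : BondConfig V | ∀ p ∈ P, ∀ q ∈ Q, ¬ (openGraph ω).Reachable p q} ∩
        {ω : BondConfig V | ∀ p ∈ P', ∀ q ∈ Q', ¬ (openGraph ω).Reachable p q}) =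
      {ω : BondConfig V | ∀ x ∈ X, ¬ (openGraph ω).Reachable s x} ∩
        ({ω : BondConfig V | ∀ p ∈ P, ∀ q ∈ Q, ¬ (openGraph ω).Reachable p q} ∩
          {ω : BondConfig V | ∀ p ∈ P', ∀ q ∈ Q', ¬ (openGraph ω).Reachable p q}) := by
    rw [hD', Set.inter_assoc, Set.inter_eq_right.2 (fun ω hω => hA hω.1)]
  have hle : (prodBernoulli w).real {ω : BondConfig V | ∀ x ∈ X ∪ Z, ¬ (openGraph ω).Reachable s x} ≤
      (prodBernoulli w).real {ω : BondConfig V | ∀ x ∈ X, ¬ (openGraph ω).Reachable s x} := by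
    rw [hD']; exact measureReal_mono Set.inter_subset_left
  rw [e1, e2, e12] at h
  exact h.trans (mul_le_mul_of_nonneg_right hle measureReal_nonneg)

/-- **THEOREM (criterion with a killing set)**: `0 ≤ E₃(D[P|Q], D[{s}|X], D[P'|Q'])` for `Q, Q' ⊆ X ∪ Z`, `s ∈ P ∩ P'`, `Z ⊆ Q ∩ Q'`. [this work] -/
theorem sahiE3_sep_notReach_sep_nonneg_kill (w : Sym2 V → unitInterval) (s : V) (X Z P Q P' Q' : Set V)
    (hQ : Q ⊆ X ∪ Z) (hQ' : Q' ⊆ X ∪ Z) (hsP : s ∈ P) (hsP' : s ∈ P') (hZQ : Z ⊆ Q) (hZQ' : Z ⊆ Q') :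
    0 ≤ sahiE3 (prodBernoulli w) {ω : BondConfig V | ∀ p ∈ P, ∀ q ∈ Q, ¬ (openGraph ω).Reachable p q}
      {ω : BondConfig V | ∀ p ∈ ({s} : Set V), ∀ q ∈ X, ¬ (openGraph ω).Reachable p q}
      {ω : BondConfig V | ∀ p ∈ P', ∀ q ∈ Q', ¬ (openGraph ω).Reachable p q} := by
  rw [sahiE3_comm₂₃, sepEv_singleton]
  have hD : IsLowerSet {ω : BondConfig V | ∀ x ∈ X, ¬ (openGraph ω).Reachable s x} := by
    rw [← sepEv_singleton]; exact isLowerSet_sepEv _ _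
  refine prodBernoulli_sahiE3_nonneg_of_condHarris_lower w (isLowerSet_sepEv P Q) (isLowerSet_sepEv P' Q') hD
    MeasurableSet.of_discrete MeasurableSet.of_discrete MeasurableSet.of_discrete ?_
  have h := sep_sep_posCorrelation_notReach_kill w s X Z P Q P' Q' hQ hQ' hsP hsP' hZQ hZQ'
  rw [Set.inter_comm _ {ω : BondConfig V | ∀ p ∈ P, ∀ q ∈ Q, ¬ (openGraph ω).Reachable p q},
    Set.inter_comm _ {ω : BondConfig V | ∀ p ∈ P', ∀ q ∈ Q', ¬ (openGraph ω).Reachable p q},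
    Set.inter_comm _ ({ω : BondConfig V | ∀ p ∈ P, ∀ q ∈ Q, ¬ (openGraph ω).Reachable p q} ∩ _)] at h
  exact h

end ClusterMarkovE3

namespace FrontierDecRows

open MeasureTheory CovTransferCert E3GroupSepCert HybridRows ClusterMarkovE3
open Literature.Probability.Percolation Literature.Probability.LatticeModels

variable {n : ℕ}

/-- **The criterion with a killing set in the `sep` vocabulary**: `0 ≤ E₃(D[P|Q], D[s|X], D[P'|Q'])` for lists with
`Q, Q' ⊆ X ∪ Z`, `s ∈ P`, `s ∈ P'`, `Z ⊆ Q`, `Z ⊆ Q'`. [this work] -/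
theorem sep_crit_kill (w : Sym2 (Fin n) → unitInterval) (s : Fin n) (X Z P Q P' Q' : List (Fin n))
    (hQ : ∀ q ∈ Q, q ∈ X ∨ q ∈ Z) (hQ' : ∀ q ∈ Q', q ∈ X ∨ q ∈ Z) (hsP : s ∈ P) (hsP' : s ∈ P')
    (hZQ : ∀ z ∈ Z, z ∈ Q) (hZQ' : ∀ z ∈ Z, z ∈ Q') :
    0 ≤ sahiE3 (prodBernoulli w) (connEvent (sep P Q)) (connEvent (sep [s] X)) (connEvent (sep P' Q')) := by
  rw [connEvent_sep_eq_setOf P Q, connEvent_sep_eq_setOf [s] X, connEvent_sep_eq_setOf P' Q']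
  have hs : ({v | v ∈ [s]} : Set (Fin n)) = {s} := by ext v; simp
  rw [hs]
  refine sahiE3_sep_notReach_sep_nonneg_kill w s {v | v ∈ X} {v | v ∈ Z} {v | v ∈ P} {v | v ∈ Q} {v | v ∈ P'} {v | v ∈ Q'}
    ?_ ?_ hsP hsP' (fun z hz => hZQ z hz) (fun z hz => hZQ' z hz)
  · intro q hq; exact hQ q hq
  · intro q hq; exact hQ' q hq

/-- Row `11` = `(D[ab|c], D[ac|by], D[ay|b])` on EVERY finite weighted graph (middle `{b ↮ ay}`, killing set `{c}`). [this work] -/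
theorem frontier_11_all (w : Sym2 (Fin n) → unitInterval) (a b c y : Fin n) :
    0 ≤ sahiE3 (prodBernoulli w) (connEvent (row 11 n (a, b, c, y)).1) (connEvent (row 11 n (a, b, c, y)).2.1)
      (connEvent (row 11 n (a, b, c, y)).2.2) := by
  have hr : row 11 n (a, b, c, y) = (sep [a, b] [c], sep [a, c] [b, y], sep [a, y] [b]) := rfl
  rw [hr, sahiE3_comm₂₃, connEvent_sep_comm [a, y] [b], connEvent_sep_comm [a, c] [b, y]]
  exact sep_crit_kill w b [a, y] [c] [a, b] [c] [b, y] [a, c] (by simp) (by simp) (by simp) (by simp) (by simp) (by simp)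

/-- Row `31` = `(D[ab|c], D[ac|y], D[bc|y])` on EVERY finite weighted graph (middle `{c ↮ ab}`, killing set `{y}`). [this work] -/
theorem frontier_31_all (w : Sym2 (Fin n) → unitInterval) (a b c y : Fin n) :
    0 ≤ sahiE3 (prodBernoulli w) (connEvent (row 31 n (a, b, c, y)).1) (connEvent (row 31 n (a, b, c, y)).2.1)
      (connEvent (row 31 n (a, b, c, y)).2.2) := by
  have hr : row 31 n (a, b, c, y) = (sep [a, b] [c], sep [a, c] [y], sep [b, c] [y]) := rfl
  rw [hr, sahiE3_comm₁₂, connEvent_sep_comm [a, b] [c]]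
  exact sep_crit_kill w c [a, b] [y] [a, c] [y] [b, c] [y] (by simp) (by simp) (by simp) (by simp) (by simp) (by simp)

end FrontierDecRows

end Summit.CriticalPhenomena.PercolationContinuityZ3.Theorems
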